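import Mathlib
import HarnessLib
import Summits.HubbardSuperconductivity.HubbardSuperconductivity.Theorems.KLProgrammeKLRegimeFatOverlapCount
import Summits.HubbardSuperconductivity.HubbardSuperconductivity.Theorems.KLProgrammeKLRegimeSliceSymbolTorus

/-!
# «(ℓ)-LEV-OV» — the overlap relation of the block propagator `S(F̃)ᵀ Γ S(F̃)` (item (I)(1) of the oriented engine twin)

The oriented block-step door of the «(ℓ)-LEV-ODD» cure (#10, crux `KLRegimeEngineV17F2`,
`stmt-HubbardSuperconductivity-20437`; k3c2-p3's `EngineV8.blockStep_ordersGe2_wtOriented_le`) takes three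
instantiation data for the sectorised block propagator `S(F̃)ᵀ Γ S(F̃)`, `F̃ = bgmFatMultiplier … n`,
`Γ = hubbardCovSliceCT L M β μ 0 K Λ Λ′`:

* an overlap relation `ov` on sector legs, with `hCov : (S(F̃)ᵀ Γ S(F̃)) X Y ≠ 0 → ov X.2 Y.2 ∧ ov Y.2 X.2`;
* a line count `hov : #{σ | ov σ σ′} ≤ c`.

This file supplies them with

  `ov σ σ′ := ∃ k, F̃ σ.1.1 k * F̃ σ′.1.1 k ≠ 0`   (same-scale fat-support overlap; spin / charge legs free)

and `c = 36 = 4 · 9`: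

* §1 `exists_mul_ne_zero_of_sectorSub_pullback_normalCovariance_ne_zero` — for ANY family `F` and ANY normal
  (momentum-diagonal) covariance, a non-zero entry of `S(F)ᵀ C S(F)` forces the two fat supports to meet: the
  double momentum sum of `sectorSub_pullback_apply` collapses on the diagonal of `normalCovariance`.
* §2 `hCov_bgmFat_hubbardCovSliceCT` — the instance for the zero-seed CT slice covariance (normal by
  `hubbardCovSliceCT_eq_normalCovariance_sliceSymbolFnXi`), both orientations.
* §3 `card_filter_overlap_bgmFat_sectorLeg_le` — `#{σ : SectorLeg (sectorCount n) | ov σ σ′} ≤ 36` for every `n`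
  (`card_overlap_bgmFat_le_nine'` times the `2 × 2` spin/charge indices; at `n = 0` there are only 8 legs).

All statements are hypothesis-free algebra / counting; no `def` is introduced (the door takes `ov` as a lambda).
-/

noncomputable section

namespace Summit.HubbardSuperconductivity.HubbardSuperconductivity.Theorems.EngineV8

set_option linter.dupNamespace false -- summit = problem name (single-conjunct summit), D-0017

open Finset Literature.MathematicalPhysics.QuantumLattice Literature.MathematicalPhysics.QuantumLattice.BandSectorCounting
open Literature.MathematicalPhysics.QuantumLattice.FermiRG Literature.Probability.LatticeModels
open Summit.HubbardSuperconductivity.HubbardSuperconductivity.Theorems.DispersionFlow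
open Summit.HubbardSuperconductivity.HubbardSuperconductivity.Theorems.PerturbedFermiCurve
open Summit.HubbardSuperconductivity.HubbardSuperconductivity.Theorems.TorusFourierL2

section Generic

open Classical

variable {L M : ℕ} [NeZero L] {N : ℕ}

/-- **Momentum conservation of a normal covariance forces fat-support overlap.** For any sector family `F` and any
normal covariance `C = normalCovariance p`, a non-zero entry `(S(F)ᵀ C S(F)) Y Y′ ≠ 0` gives a momentum `k` with
`F_{ω(Y)}(k) · F_{ω(Y′)}(k) ≠ 0`. -/
theorem exists_mul_ne_zero_of_sectorSub_pullback_normalCovariance_ne_zero (β : ℝ)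
    (F : Fin N → FreqMomentum L M → ℂ) (p : FreqMomentum L M × Fin 2 → ℂ) {Y Y' : SpaceTimeIdx L M × SectorLeg N}
    (h : ((sectorSubMatrix L M β F).transpose * normalCovariance L M p * sectorSubMatrix L M β F) Y Y' ≠ 0) :
    ∃ k : FreqMomentum L M, F Y.2.1.1 k * F Y'.2.1.1 k ≠ 0 := by
  rw [sectorSub_pullback_apply] at h
  obtain ⟨k, -, hk⟩ := exists_ne_zero_of_sum_ne_zero h
  obtain ⟨k', -, hk'⟩ := exists_ne_zero_of_sum_ne_zero hk
  have hC : normalCovariance L M p ((k, Y.2.1.2), Y.2.2) ((k', Y'.2.1.2), Y'.2.2) ≠ 0 := by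
    intro h0
    exact hk' (by rw [h0, mul_zero, zero_mul])
  have hkk : k = k' := by
    rw [normalCovariance_apply] at hC
    by_contra hne
    exact hC (if_neg fun heq => hne (congrArg Prod.fst heq))
  subst hkk
  refine ⟨k, fun h0 => hk' ?_⟩
  rcases mul_eq_zero.1 h0 with h1 | h1
  · rw [h1, zero_mul, mul_zero, zero_mul, zero_mul]
  · rw [h1, zero_mul, mul_zero, mul_zero]

/-- Spin conservation rides along: a non-zero entry of `S(F)ᵀ (normalCovariance p) S(F)` has equal spin legs. -/
theorem spin_eq_of_sectorSub_pullback_normalCovariance_ne_zero (β : ℝ)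
    (F : Fin N → FreqMomentum L M → ℂ) (p : FreqMomentum L M × Fin 2 → ℂ) {Y Y' : SpaceTimeIdx L M × SectorLeg N}
    (h : ((sectorSubMatrix L M β F).transpose * normalCovariance L M p * sectorSubMatrix L M β F) Y Y' ≠ 0) :
    Y.2.1.2 = Y'.2.1.2 := by
  rw [sectorSub_pullback_apply] at h
  obtain ⟨k, -, hk⟩ := exists_ne_zero_of_sum_ne_zero h
  obtain ⟨k', -, hk'⟩ := exists_ne_zero_of_sum_ne_zero hk
  have hC : normalCovariance L M p ((k, Y.2.1.2), Y.2.2) ((k', Y'.2.1.2), Y'.2.2) ≠ 0 := by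
    intro h0
    exact hk' (by rw [h0, mul_zero, zero_mul])
  rw [normalCovariance_apply] at hC
  by_contra hne
  exact hC (if_neg fun heq : ((k, Y.2.1.2) : FreqMomentum L M × Fin 2) = (k', Y'.2.1.2) =>
    hne (Prod.mk.inj heq).2)

end Generic

section Hubbard

open Classical

variable {L M : ℕ} [NeZero L]

/-- **`hCov` for the block propagator.** For the zero-seed CT slice covariance `Γ = C^K_{(Λ,Λ′]}` (normal, with symbol
`Ψ̂_ω(e_K)`) and the fat sector family `F̃ = bgmFatMultiplier … n`, a non-zero entry of `S(F̃)ᵀ Γ S(F̃)` forces the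
fat supports of the two sector legs to overlap — in both orders (the relation is symmetric). This is the `hCov`
hypothesis of the oriented block-step door with `ov σ σ′ := ∃ k, F̃ σ.1.1 k * F̃ σ′.1.1 k ≠ 0`. -/
theorem hCov_bgmFat_hubbardCovSliceCT {β : ℝ} (hβ : β ≠ 0) (μ e₀ : ℝ) (K : TrigPolyC4v) (Λ Λ' : ℝ) (n : ℕ)
    (X Y : SpaceTimeIdx L M × SectorLeg (sectorCount n))
    (h : ((sectorSubMatrix L M β (bgmFatMultiplier L M e₀ β (nambuXiCT L μ K) n)).transpose *
        hubbardCovSliceCT L M β μ 0 K Λ Λ' *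
        sectorSubMatrix L M β (bgmFatMultiplier L M e₀ β (nambuXiCT L μ K) n)) X Y ≠ 0) :
    (∃ k : FreqMomentum L M, bgmFatMultiplier L M e₀ β (nambuXiCT L μ K) n X.2.1.1 k *
        bgmFatMultiplier L M e₀ β (nambuXiCT L μ K) n Y.2.1.1 k ≠ 0) ∧
      (∃ k : FreqMomentum L M, bgmFatMultiplier L M e₀ β (nambuXiCT L μ K) n Y.2.1.1 k *
        bgmFatMultiplier L M e₀ β (nambuXiCT L μ K) n X.2.1.1 k ≠ 0) := by
  rw [hubbardCovSliceCT_eq_normalCovariance_sliceSymbolFnXi hβ] at h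
  obtain ⟨k, hk⟩ := exists_mul_ne_zero_of_sectorSub_pullback_normalCovariance_ne_zero β _ _ h
  exact ⟨⟨k, hk⟩, ⟨k, by rwa [mul_comm] at hk⟩⟩

/-- Spin legs of a non-zero entry of the block propagator agree. -/
theorem spin_eq_of_bgmFat_hubbardCovSliceCT_ne_zero {β : ℝ} (hβ : β ≠ 0) (μ e₀ : ℝ) (K : TrigPolyC4v) (Λ Λ' : ℝ)
    (n : ℕ) (X Y : SpaceTimeIdx L M × SectorLeg (sectorCount n))
    (h : ((sectorSubMatrix L M β (bgmFatMultiplier L M e₀ β (nambuXiCT L μ K) n)).transpose *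
        hubbardCovSliceCT L M β μ 0 K Λ Λ' *
        sectorSubMatrix L M β (bgmFatMultiplier L M e₀ β (nambuXiCT L μ K) n)) X Y ≠ 0) :
    X.2.1.2 = Y.2.1.2 := by
  rw [hubbardCovSliceCT_eq_normalCovariance_sliceSymbolFnXi hβ] at h
  exact spin_eq_of_sectorSub_pullback_normalCovariance_ne_zero β _ _ h

end Hubbard

section Count

open Classical

variable {L M : ℕ} [NeZero L] {μ e₀ β : ℝ} {K : TrigPolyC4v}

omit [NeZero L] in
/-- Counting over sector LEGS a predicate of the sector INDEX only: the `2 × 2` spin/charge indices multiply by `4`. -/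
theorem card_filter_sectorLeg_of_index {N : ℕ} (P : Fin N → Prop) [DecidablePred P] :
    ((univ : Finset (SectorLeg N)).filter (fun σ : SectorLeg N => P σ.1.1)).card =
      ((univ : Finset (Fin N)).filter P).card * 4 := by
  have hset : (univ : Finset (SectorLeg N)).filter (fun σ : SectorLeg N => P σ.1.1) =
      (((univ : Finset (Fin N)).filter P) ×ˢ (univ : Finset (Fin 2))) ×ˢ (univ : Finset (Fin 2)) := by
    ext σ
    simp only [mem_filter, mem_univ, true_and, mem_product, and_true]
  rw [hset, card_product, card_product, card_univ, Fintype.card_fin]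
  ring

/-- **`hov` for the block propagator, `c = 36`.** For every sector leg `σ′` of the fat family at index `n`, at most
`36 = 9 · 4` sector legs `σ` have fat support meeting that of `σ′` (`card_overlap_bgmFat_le_nine'` for the sector
index, times the free `2 × 2` spin/charge indices; at `n = 0` there are only `8` legs). -/
theorem card_filter_overlap_bgmFat_sectorLeg_le (n : ℕ) (σ' : SectorLeg (sectorCount n)) :
    ((univ : Finset (SectorLeg (sectorCount n))).filter (fun σ : SectorLeg (sectorCount n) =>
      ∃ k : FreqMomentum L M, bgmFatMultiplier L M e₀ β (nambuXiCT L μ K) n σ.1.1 k *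
        bgmFatMultiplier L M e₀ β (nambuXiCT L μ K) n σ'.1.1 k ≠ 0)).card ≤ 36 := by
  refine (le_of_eq (card_filter_sectorLeg_of_index (fun ω : Fin (sectorCount n) =>
    ∃ k : FreqMomentum L M, bgmFatMultiplier L M e₀ β (nambuXiCT L μ K) n ω k *
      bgmFatMultiplier L M e₀ β (nambuXiCT L μ K) n σ'.1.1 k ≠ 0))).trans ?_
  rcases n with _ | m
  · -- `sectorCount 0 = 2`: at most `2 · 4 = 8` legs in all
    have hle : ((univ : Finset (Fin (sectorCount 0))).filter (fun ω : Fin (sectorCount 0) =>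
        ∃ k : FreqMomentum L M, bgmFatMultiplier L M e₀ β (nambuXiCT L μ K) 0 ω k *
          bgmFatMultiplier L M e₀ β (nambuXiCT L μ K) 0 σ'.1.1 k ≠ 0)).card ≤ 2 :=
      (card_filter_le _ _).trans (by rw [card_univ, Fintype.card_fin]; simp [sectorCount])
    exact (Nat.mul_le_mul_right 4 hle).trans (by norm_num)
  · exact (Nat.mul_le_mul_right 4 (card_overlap_bgmFat_le_nine' (L := L) (M := M) (K := K) (μ := μ) (e₀ := e₀)
      (β := β) m σ'.1.1)).trans (by norm_num)

/-- The symmetric reading of `hov` (count the second argument): also `≤ 36`. -/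
theorem card_filter_overlap_bgmFat_sectorLeg_le' (n : ℕ) (σ : SectorLeg (sectorCount n)) :
    ((univ : Finset (SectorLeg (sectorCount n))).filter (fun σ' : SectorLeg (sectorCount n) =>
      ∃ k : FreqMomentum L M, bgmFatMultiplier L M e₀ β (nambuXiCT L μ K) n σ.1.1 k *
        bgmFatMultiplier L M e₀ β (nambuXiCT L μ K) n σ'.1.1 k ≠ 0)).card ≤ 36 := by
  refine le_trans (card_le_card (monotone_filter_right _ fun σ' _ hσ' => ?_))
    (card_filter_overlap_bgmFat_sectorLeg_le (L := L) (M := M) (K := K) (μ := μ) (e₀ := e₀) (β := β) n σ)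
  obtain ⟨k, hk⟩ := hσ'
  exact ⟨k, by rwa [mul_comm] at hk⟩

end Count

end Summit.HubbardSuperconductivity.HubbardSuperconductivity.Theorems.EngineV8

end
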